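/-
Copyright (c) 2026 the pub-hodgecm-mathlib formalisation cell (harness21).  Prover seat hodgecm-mathlib-K2E1-p08 (g4), Track B ∕ K2-LIT, h413 =
`stmt-HodgeConjecture-24833`, line `K2_E1_TraceFormulaBeta`, campaign «EIS-RANK-ONE» rung R2 «Godement»; DEAL «EIS-U3-GODEMENT» of the dealer K2E1-plan (g3)
2026-09-04T04:19:39Z ∕ ruling R-EIS-1 ∕ «=» 04:38:21Z, file (G2): E5 (Godement's parabolic integral on `B(𝔸)`) ⟹ E4 (the Siegel-domain integral on `G(𝔸)`).
-/
import Summits.HodgeConjecture.HodgeConjecture.Theorems.K2E1BorelEisensteinGodementU    -- ★ p857410 (this seat): Godement's criterion given E4; smear; `borelHeight_mul_of_adelicVal_mem`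
import HarnessLib

/-!
# K2·E1 — `K2E1BorelParabolicReductionU`: THE SIEGEL-DOMAIN INTEGRAL E4 ON `G(𝔸) = U(J_N)(𝔸_F)` FROM GODEMENT'S PARABOLIC INTEGRAL E5 ON `B(𝔸)`
# (the compact `K_U` integrated out; campaign EIS-RANK-ONE, rung R2, file (G2))

Track B ∕ K2-LIT, crux h413 = `stmt-HodgeConjecture-24833`, route of record `HCCMUnconditional`; cell `hodgecm-mathlib`, squad K2, ENGINE E1.  Prover seat
`hodgecm-mathlib-K2E1-p08` (g4); DEAL «EIS-U3-GODEMENT» (K2E1-plan (g3) 04:19:39Z; ruling R-EIS-1; split «=» 04:38:21Z), file (G2).  THEOREMS ONLY (no `def`, no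
`instance`, no notation, no named-fact hypothesis, no `sorry`); lane `--kind proof --supports stmt-HodgeConjecture-24833 --as helper` (count-neutral).  Carrier-specific twin
(Mok's `quasiSplit F E c N`, any `N`) of ★ `K2LiuSiegelDoubledParabolicReduction` §3–§4.

THE TWO TOKENS (frozen with K2E4-p11 (g3)'s (G3) heads v1, 04:50:32Z ∕ 04:58Z):
* **E5(τ)** on `B(𝔸) = ↥(borelAdelic F E c N)` with a Haar measure `μ_B` and a covering weight `w₁` of `B(F)_B := (arithmeticSubgroup).subgroupOf (borelAdelic)`:
  `∀ C₀, ∫⁻ b, 𝟙{H b ≤ C₀} · ofReal (H b ^ τ) · w₁ b ∂μ_B ≠ ∞` (`H b := borelHeight (b : G(𝔸))`) — file (G3) `K2E1BorelParabolicIntegralU3` proves it for `N = 3`, `τ > 2`;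
* **E4(τ)** on `G(𝔸)` with a Haar measure `μ` and a covering weight `β'` of `Γ' := borelAdelic ⊓ arithmeticSubgroup`:
  `∀ C₀, ∫⁻ y, 𝟙{H y ≤ C₀} · ofReal (H y ^ τ) · β' y ∂μ ≠ ∞` — the hypothesis of ★ (G) `summable_borelHeight_rpow_of_siegelIntegral`.

* §1 `B(F)_B` is countable; `B(F)_B ≃ Γ'` (same elements); `borelHeight_coe_mul_of_mem_subgroupOf` (`H(δ b) = H(b)` for `δ ∈ B(F)_B`).
* §2 **`coveringSum_kAverage`** — the `K_U`-average `w(b) = ∫⁻_{K_U} β'(b k) dμ_K` of a `Γ'`-weight `β'` on `G(𝔸)` is a `B(F)_B`-weight on `B(𝔸)` of mass `μ_K(K_U)` (Tonelli).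
* §3 **THE REDUCTION `siegelIntegral_ne_top_of_parabolicIntegral`: Iwasawa `hIw` + E5(τ) for ONE (`μ_B`, `w₁`) ⟹ E4(τ) for EVERY Haar `μ` and EVERY `Γ'`-weight `β'`** —
  `∫⁻_G F = C ∫⁻_B ∫⁻_{K_U} F(b k)` (★ `exists_lintegral_eq_mul_lintegral_borel_lintegral_maximalCompact`), `H(b k) = H(b)` EXACTLY on `K_U` (★ (G)
  `borelHeight_mul_of_adelicVal_mem` — no constants: the Borel height is `K_U`-invariant), §2, and weight independence (★ `lintegral_mul_eq_of_coveringSum_eq`); the packaged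
  form `exists_siegelIntegral_of_parabolicIntegral` (E5-∃ ⟹ E4-∃, `β'` from ★ `exists_isCoveringWeight`, `Γ'` discrete by ★ `isDiscreteRational_quasiSplit`).
* §4 END-TO-END modulo E5: `summable_borelHeight_rpow_of_parabolicIntegral` (any `N`: `hIw`, `hceil`, E5 ⟹ `∀ g, Summable (q ↦ H(γ̃_q g)^τ)`), `…_three_…` (ceiling ★ big cell) and at the
  CM pair **`summable_borelHeight_rpow_cm_three_of_parabolicIntegral`** ∕ **`summable_norm_flatSectionU_cm_three_of_parabolicIntegral`** (`‖φ‖ ≤ M`, `τ = Re z ≥ 0`) — so that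
  R2 at `N = 3` closes by one `exact` on (G3)'s `parabolicIntegral_borel_three`.
HONEST LABEL: HC_CM is proved only modulo the 7 printed citations (2 remaining named inputs: hLiu418 = `stmt-HodgeConjecture-24832`, h413 = `stmt-HodgeConjecture-24833`) until rung 0
closes; count-neutral helper, proves no printed statement, closes no socket.
References: [Godement1964] R. Godement, Sém. Bourbaki 257, §8 · [Garrett2018] P. Garrett, *Modern Analysis of Automorphic Forms by Example* (2018), §3.10 (proof of Cor. 3.10.2) ·
[DeitmarEchterhoff2014] A. Deitmar, S. Echterhoff, *Principles of Harmonic Analysis* (2014), Prop. 1.5.6 · [MoeglinWaldspurger1995] C. Mœglin, J.-L. Waldspurger, *Spectral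
Decomposition and Eisenstein Series* (1995), II.1.5.
-/

set_option autoImplicit false
-- the mandated namespace repeats the single-problem summit's segment (`HodgeConjecture.HodgeConjecture`)
set_option linter.dupNamespace false

noncomputable section

open MeasureTheory MeasureTheory.Measure Set Filter Topology MulAction NumberField IsDedekindDomain
open scoped ENNReal NNReal Pointwise MatrixGroups
open Literature.MeasureTheory.Group
open Literature.NumberTheory.Automorphic Literature.NumberTheory.Automorphic.UnitaryGroup
open Summit.HodgeConjecture.HodgeConjecture.Cruxes.H413.K2E1BorelEisensteinU
open Summit.HodgeConjecture.HodgeConjecture.Cruxes.H413.K2E1BorelEisensteinGodementU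

namespace Summit.HodgeConjecture.HodgeConjecture.Cruxes.H413.K2E1BorelParabolicReductionU

variable {F E : Type} [Field F] [NumberField F] [Field E] [NumberField E] [Algebra F E] {c : E ≃ₐ[F] E} {N : ℕ}

/-! ## §1 The rational Borel `B(F)_B` inside `B(𝔸)` -/

/-- `B(F)_B := G(F) ∩ B(𝔸)` as a subgroup of `B(𝔸)` is countable (it injects into the countable `G(F)`). [cite: Garrett2018, §1.8] -/
theorem countable_borelRat : Countable ↥(((quasiSplit F E c N).arithmeticSubgroup).subgroupOf (borelAdelic F E c N)) := by
  haveI : Countable (quasiSplit F E c N).arithmeticSubgroup := by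
    haveI : Countable (quasiSplit F E c N).Rational := countable_unitaryGroupOfForm (c := c) ((StdForm.antidiagonal N).over E)
    exact (Set.countable_range (quasiSplit F E c N).toAdelic).to_subtype
  have hinj : Function.Injective fun δ : ↥(((quasiSplit F E c N).arithmeticSubgroup).subgroupOf (borelAdelic F E c N)) =>
      (⟨((δ : borelAdelic F E c N) : (quasiSplit F E c N).Adelic), Subgroup.mem_subgroupOf.1 δ.2⟩ : (quasiSplit F E c N).arithmeticSubgroup) := by
    intro a b h
    exact Subtype.ext (Subtype.ext (congrArg (fun z : (quasiSplit F E c N).arithmeticSubgroup => (z : (quasiSplit F E c N).Adelic)) h))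
  exact hinj.countable

/-- `B(F)_B ≃ Γ' = B(𝔸) ⊓ G(F)` — the same elements typed in `B(𝔸)` resp. in `G(𝔸)`. [folklore] -/
theorem exists_equiv_borelRat :
    ∃ ι : ↥(((quasiSplit F E c N).arithmeticSubgroup).subgroupOf (borelAdelic F E c N)) ≃ ↥(borelAdelic F E c N ⊓ (quasiSplit F E c N).arithmeticSubgroup),
      ∀ δ, ((ι δ : ↥(borelAdelic F E c N ⊓ (quasiSplit F E c N).arithmeticSubgroup)) : (quasiSplit F E c N).Adelic) =
        ((δ : borelAdelic F E c N) : (quasiSplit F E c N).Adelic) :=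
  ⟨{ toFun := fun δ => ⟨((δ : borelAdelic F E c N) : (quasiSplit F E c N).Adelic), Subgroup.mem_inf.2 ⟨δ.1.2, Subgroup.mem_subgroupOf.1 δ.2⟩⟩
     invFun := fun γ => ⟨⟨(γ : (quasiSplit F E c N).Adelic), (Subgroup.mem_inf.1 γ.2).1⟩, Subgroup.mem_subgroupOf.2 (Subgroup.mem_inf.1 γ.2).2⟩
     left_inv := fun _ => rfl
     right_inv := fun _ => rfl }, fun _ => rfl⟩

variable [NeZero N] in
/-- `H(δ b) = H(b)` for `δ ∈ B(F)_B` (★ (G) `borelHeight_mul_of_mem_inf`). [cite: Garrett2018, §2.2] -/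
theorem borelHeight_coe_smul_of_borelRat (δ : ↥(((quasiSplit F E c N).arithmeticSubgroup).subgroupOf (borelAdelic F E c N))) (b : borelAdelic F E c N) :
    borelHeight (((δ • b : borelAdelic F E c N)) : (quasiSplit F E c N).Adelic) = borelHeight ((b : borelAdelic F E c N) : (quasiSplit F E c N).Adelic) := by
  change borelHeight ((((δ : borelAdelic F E c N) * b : borelAdelic F E c N)) : (quasiSplit F E c N).Adelic) = _
  rw [Subgroup.coe_mul]
  exact borelHeight_mul_of_mem_inf (Subgroup.mem_inf.2 ⟨(δ : borelAdelic F E c N).2, Subgroup.mem_subgroupOf.1 δ.2⟩) _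

/-! ## §2 The `K_U`-average of a `Γ'`-weight is a `B(F)_B`-weight of mass `μ_K(K_U)` -/

section Weights

variable [MeasurableSpace (quasiSplit F E c N).Adelic] [BorelSpace (quasiSplit F E c N).Adelic]

/-- **`Σ_{δ ∈ B(F)_B} ∫⁻_{K_U} β'(δ b k) dμ_K = μ_K(K_U)`** for a `Γ'`-covering weight `β'` on `G(𝔸)` (Tonelli; `Σ_{γ'∈Γ'} β'(γ' x) = 1`). [cite: Garrett2018, §3.10] -/
theorem coveringSum_kAverage
    (μK : Measure ↥(((standardMaximalCompactGL N E).comap (adelicVal F E c N ((StdForm.antidiagonal N).over E)) : Subgroup (quasiSplit F E c N).Adelic)))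
    [SFinite μK] {β' : (quasiSplit F E c N).Adelic → ℝ≥0∞} (hβ' : IsCoveringWeight ↥(borelAdelic F E c N ⊓ (quasiSplit F E c N).arithmeticSubgroup) β')
    (b : borelAdelic F E c N) :
    coveringSum ↥(((quasiSplit F E c N).arithmeticSubgroup).subgroupOf (borelAdelic F E c N))
        (fun q : borelAdelic F E c N => ∫⁻ k, β' ((q : (quasiSplit F E c N).Adelic) * (k : (quasiSplit F E c N).Adelic)) ∂μK) b = μK Set.univ := by
  haveI := countable_borelRat (F := F) (E := E) (c := c) (N := N)
  obtain ⟨ι, hι⟩ := exists_equiv_borelRat (F := F) (E := E) (c := c) (N := N)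
  rw [coveringSum_apply]
  have hmeas : ∀ δ : ↥(((quasiSplit F E c N).arithmeticSubgroup).subgroupOf (borelAdelic F E c N)),
      Measurable fun k : ↥(((standardMaximalCompactGL N E).comap (adelicVal F E c N ((StdForm.antidiagonal N).over E)) : Subgroup (quasiSplit F E c N).Adelic)) =>
        β' ((((δ • b : borelAdelic F E c N)) : (quasiSplit F E c N).Adelic) * (k : (quasiSplit F E c N).Adelic)) := fun δ =>
    hβ'.1.comp ((continuous_const.mul continuous_subtype_val).measurable)
  rw [← lintegral_tsum fun δ => (hmeas δ).aemeasurable]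
  have hpt : ∀ k : ↥(((standardMaximalCompactGL N E).comap (adelicVal F E c N ((StdForm.antidiagonal N).over E)) : Subgroup (quasiSplit F E c N).Adelic)),
      (∑' δ : ↥(((quasiSplit F E c N).arithmeticSubgroup).subgroupOf (borelAdelic F E c N)),
        β' ((((δ • b : borelAdelic F E c N)) : (quasiSplit F E c N).Adelic) * (k : (quasiSplit F E c N).Adelic))) = 1 := by
    intro k
    have h1 := hβ'.2 (((b : borelAdelic F E c N) : (quasiSplit F E c N).Adelic) * (k : (quasiSplit F E c N).Adelic))
    rw [coveringSum_apply, ← Equiv.tsum_eq ι] at h1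
    rw [← h1]
    refine tsum_congr fun δ => ?_
    show β' ((((δ : borelAdelic F E c N) : (quasiSplit F E c N).Adelic)) * ((b : borelAdelic F E c N) : (quasiSplit F E c N).Adelic) *
      (k : (quasiSplit F E c N).Adelic)) = β' (((ι δ : ↥(borelAdelic F E c N ⊓ (quasiSplit F E c N).arithmeticSubgroup)) : (quasiSplit F E c N).Adelic) *
        (((b : borelAdelic F E c N) : (quasiSplit F E c N).Adelic) * (k : (quasiSplit F E c N).Adelic)))
    rw [hι δ, mul_assoc]
  simp_rw [hpt]
  rw [lintegral_const, one_mul]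

end Weights

/-! ## §3 The reduction E5 ⟹ E4 -/

section Reduction

variable [NeZero N] [MeasurableSpace (quasiSplit F E c N).Adelic] [BorelSpace (quasiSplit F E c N).Adelic]

/-- **E5 ⟹ E4: THE SIEGEL-DOMAIN INTEGRAL ON `G(𝔸)` FROM GODEMENT'S PARABOLIC INTEGRAL ON `B(𝔸)`.**  Let `μ` be a Haar measure on `G(𝔸) = U(J_N)(𝔸_F)`,
`G(𝔸) = B(𝔸)·K_U` (Iwasawa, `hIw`), `μ_B` a Haar measure on `B(𝔸)` and `w₁` a `B(F)_B`-covering weight with `∫⁻_B 𝟙{H ≤ C₀} H^τ w₁ dμ_B < ∞` for every `C₀` (E5).  Then for EVERY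
`Γ'`-covering weight `β'` on `G(𝔸)` and every `C₀`, `∫⁻_G 𝟙{H ≤ C₀} H^τ β' dμ < ∞` (E4).  Proof: `∫⁻_G = C ∫⁻_B ∫⁻_{K_U}` (★); on `b k` the integrand is `(𝟙{H≤C₀}H^τ)(b) · β'(b k)` because
`H(b k) = H(b)` (★ (G)); the `K_U`-integral of `β'(b ·)` is a `B(F)_B`-weight of mass `μ_K(K_U)` (§2), exchanged for `μ_K(K_U) · w₁` (★ weight independence).
[cite: Godement1964, §8] [cite: Garrett2018, §3.10 (proof of Cor. 3.10.2)] [cite: DeitmarEchterhoff2014, Prop. 1.5.6] [cite: MoeglinWaldspurger1995, II.1.5] -/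
theorem siegelIntegral_ne_top_of_parabolicIntegral (μ : Measure (quasiSplit F E c N).Adelic) [μ.IsHaarMeasure]
    (hIw : ∀ g : (quasiSplit F E c N).Adelic, ∃ b ∈ borelAdelic F E c N, ∃ k : (quasiSplit F E c N).Adelic,
      adelicVal F E c N ((StdForm.antidiagonal N).over E) k ∈ standardMaximalCompactGL N E ∧ g = b * k)
    (μB : Measure (borelAdelic F E c N)) [μB.IsHaarMeasure] {τ : ℝ} {w₁ : borelAdelic F E c N → ℝ≥0∞}
    (hw₁ : IsCoveringWeight ↥(((quasiSplit F E c N).arithmeticSubgroup).subgroupOf (borelAdelic F E c N)) w₁)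
    (hE5 : ∀ C₀ : ℝ≥0, ∫⁻ b, {b : borelAdelic F E c N | borelHeight (b : (quasiSplit F E c N).Adelic) ≤ C₀}.indicator
        (fun b => ENNReal.ofReal ((borelHeight (b : (quasiSplit F E c N).Adelic) : ℝ) ^ τ)) b * w₁ b ∂μB ≠ ∞)
    {β' : (quasiSplit F E c N).Adelic → ℝ≥0∞} (hβ' : IsCoveringWeight ↥(borelAdelic F E c N ⊓ (quasiSplit F E c N).arithmeticSubgroup) β') (C₀ : ℝ≥0) :
    ∫⁻ y, {y | borelHeight y ≤ C₀}.indicator (fun y => ENNReal.ofReal ((borelHeight y : ℝ) ^ τ)) y * β' y ∂μ ≠ ∞ := by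
  classical
  haveI := countable_borelRat (F := F) (E := E) (c := c) (N := N)
  -- the compact group `K_U` and a Haar measure on it
  have hKc : IsCompact (((standardMaximalCompactGL N E).comap (adelicVal F E c N ((StdForm.antidiagonal N).over E)) : Subgroup (quasiSplit F E c N).Adelic) : Set (quasiSplit F E c N).Adelic) := isCompact_comap_adelicVal_standardMaximalCompactGL
  haveI : CompactSpace ↥((standardMaximalCompactGL N E).comap (adelicVal F E c N ((StdForm.antidiagonal N).over E)) : Subgroup (quasiSplit F E c N).Adelic) := isCompact_iff_compactSpace.1 hKc
  haveI : T2Space (quasiSplit F E c N).Adelic := inferInstanceAs (T2Space (adelic F E c N ((StdForm.antidiagonal N).over E)))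
  haveI : SecondCountableTopology (quasiSplit F E c N).Adelic := inferInstanceAs (SecondCountableTopology (adelic F E c N ((StdForm.antidiagonal N).over E)))
  haveI : SecondCountableTopology ↥((standardMaximalCompactGL N E).comap (adelicVal F E c N ((StdForm.antidiagonal N).over E)) : Subgroup (quasiSplit F E c N).Adelic) := TopologicalSpace.Subtype.secondCountableTopology _
  haveI : SecondCountableTopology (borelAdelic F E c N) := secondCountableTopology_borelAdelic
  haveI : LocallyCompactSpace (borelAdelic F E c N) := locallyCompactSpace_borelAdelic
  haveI : Nonempty ↥((standardMaximalCompactGL N E).comap (adelicVal F E c N ((StdForm.antidiagonal N).over E)) : Subgroup (quasiSplit F E c N).Adelic) := ⟨1⟩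
  set μK : Measure ↥((standardMaximalCompactGL N E).comap (adelicVal F E c N ((StdForm.antidiagonal N).over E)) : Subgroup (quasiSplit F E c N).Adelic) := Measure.haarMeasure (⟨⟨Set.univ, isCompact_univ⟩, by simp⟩ : TopologicalSpace.PositiveCompacts ↥((standardMaximalCompactGL N E).comap (adelicVal F E c N ((StdForm.antidiagonal N).over E)) : Subgroup (quasiSplit F E c N).Adelic)) with hμK
  have hμKtop : μK Set.univ ≠ ∞ := (IsCompact.measure_lt_top isCompact_univ).ne
  have hμK0 : μK Set.univ ≠ 0 := isOpen_univ.measure_ne_zero μK Set.univ_nonempty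
  -- `∫⁻_G = C ∫⁻_B ∫⁻_{K_U}`
  obtain ⟨C, hC0, hCtop, hGBK⟩ := exists_lintegral_eq_mul_lintegral_borel_lintegral_maximalCompact hIw μ μB μK
  -- the integrand on `G(𝔸)` and on `B(𝔸)`
  set Fτ : (quasiSplit F E c N).Adelic → ℝ≥0∞ := fun y => {y | borelHeight y ≤ C₀}.indicator (fun y => ENNReal.ofReal ((borelHeight y : ℝ) ^ τ)) y * β' y with hFτ
  have hpow : Measurable fun y : (quasiSplit F E c N).Adelic => ENNReal.ofReal ((borelHeight y : ℝ) ^ τ) :=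
    ENNReal.measurable_ofReal.comp ((measurable_borelHeight.coe_nnreal_real).pow_const τ)
  have hFm : Measurable Fτ := (hpow.indicator (isClosed_setOf_borelHeight_le _).measurableSet).mul hβ'.1
  set g : borelAdelic F E c N → ℝ≥0∞ := fun b => {b : borelAdelic F E c N | borelHeight (b : (quasiSplit F E c N).Adelic) ≤ C₀}.indicator
    (fun b => ENNReal.ofReal ((borelHeight (b : (quasiSplit F E c N).Adelic) : ℝ) ^ τ)) b with hg
  have hHm : Measurable fun b : borelAdelic F E c N => borelHeight (b : (quasiSplit F E c N).Adelic) := measurable_borelHeight.comp measurable_subtype_coe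
  have hgm : Measurable g := (ENNReal.measurable_ofReal.comp (hHm.coe_nnreal_real.pow_const τ)).indicator (measurableSet_le hHm measurable_const)
  have hgtop : ∀ b, g b ≠ ∞ := fun b => ne_top_of_le_ne_top ENNReal.ofReal_ne_top (Set.indicator_le_self _ _ b)
  -- on `b k`: `Fτ (b k) = g b * β' (b k)` since `H(b k) = H(b)`
  have hpt : ∀ (b : borelAdelic F E c N) (k : ↥((standardMaximalCompactGL N E).comap (adelicVal F E c N ((StdForm.antidiagonal N).over E)) : Subgroup (quasiSplit F E c N).Adelic)), Fτ ((b : (quasiSplit F E c N).Adelic) * (k : (quasiSplit F E c N).Adelic)) =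
      g b * β' ((b : (quasiSplit F E c N).Adelic) * (k : (quasiSplit F E c N).Adelic)) := by
    intro b k
    have hHbk : borelHeight ((b : (quasiSplit F E c N).Adelic) * (k : (quasiSplit F E c N).Adelic)) = borelHeight (b : (quasiSplit F E c N).Adelic) :=
      borelHeight_mul_of_adelicVal_mem (Subgroup.mem_comap.1 k.2) _
    simp only [hFτ, hg, Set.indicator_apply, Set.mem_setOf_eq, hHbk]
  -- integrate over `K_U`
  set w : borelAdelic F E c N → ℝ≥0∞ := fun b => ∫⁻ k, β' ((b : (quasiSplit F E c N).Adelic) * (k : (quasiSplit F E c N).Adelic)) ∂μK with hw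
  have hKint : ∀ b : borelAdelic F E c N, ∫⁻ k, Fτ ((b : (quasiSplit F E c N).Adelic) * (k : (quasiSplit F E c N).Adelic)) ∂μK = g b * w b := by
    intro b
    simp_rw [hpt b]
    rw [hw, lintegral_const_mul' _ _ (hgtop b)]
  -- `w` is a `B(F)_B`-weight of mass `μ_K(K_U)`; exchange it for `μ_K(K_U) · w₁`
  have hwm : Measurable w := by
    rw [hw]
    refine Measurable.lintegral_prod_right ?_
    exact hβ'.1.comp ((continuous_subtype_val.comp continuous_fst).mul (continuous_subtype_val.comp continuous_snd)).measurable
  haveI : MeasurableConstSMul ↥(((quasiSplit F E c N).arithmeticSubgroup).subgroupOf (borelAdelic F E c N)) (borelAdelic F E c N) :=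
    ⟨fun δ => measurable_const_mul (δ : borelAdelic F E c N)⟩
  haveI : SMulInvariantMeasure ↥(((quasiSplit F E c N).arithmeticSubgroup).subgroupOf (borelAdelic F E c N)) (borelAdelic F E c N) μB :=
    ⟨fun δ s _hs => by
      rw [show (fun x : borelAdelic F E c N => δ • x) ⁻¹' s = (fun x : borelAdelic F E c N => (δ : borelAdelic F E c N) * x) ⁻¹' s from rfl, measure_preimage_mul]⟩
  have hginv : ∀ (δ : ↥(((quasiSplit F E c N).arithmeticSubgroup).subgroupOf (borelAdelic F E c N))) (b : borelAdelic F E c N), g (δ • b) = g b := by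
    intro δ b
    simp only [hg, Set.indicator_apply, Set.mem_setOf_eq, borelHeight_coe_smul_of_borelRat δ b]
  have hwsum : ∀ b : borelAdelic F E c N, coveringSum ↥(((quasiSplit F E c N).arithmeticSubgroup).subgroupOf (borelAdelic F E c N)) w b = μK Set.univ := fun b =>
    coveringSum_kAverage μK hβ' b
  have hw₁sum : ∀ b : borelAdelic F E c N, coveringSum ↥(((quasiSplit F E c N).arithmeticSubgroup).subgroupOf (borelAdelic F E c N))
      (fun q => μK Set.univ * w₁ q) b = μK Set.univ := fun b => by
    rw [coveringSum_const_mul, hw₁.2 b, mul_one]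
  have hexch : ∫⁻ b, g b * w b ∂μB = ∫⁻ b, g b * (μK Set.univ * w₁ b) ∂μB :=
    lintegral_mul_eq_of_coveringSum_eq μB hgm hginv hwm (hw₁.1.const_mul _) hμK0 hμKtop hwsum hw₁sum
  -- assemble
  change ∫⁻ y, Fτ y ∂μ ≠ ∞
  rw [hGBK Fτ hFm]
  simp_rw [hKint]
  rw [hexch]
  have hsplit : ∫⁻ b, g b * (μK Set.univ * w₁ b) ∂μB = μK Set.univ * ∫⁻ b, g b * w₁ b ∂μB := by
    simp_rw [← mul_assoc, mul_comm (g _) (μK Set.univ), mul_assoc]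
    rw [lintegral_const_mul' _ _ hμKtop]
  rw [hsplit]
  exact ENNReal.mul_ne_top hCtop (ENNReal.mul_ne_top hμKtop (hE5 C₀))

/-- **E5-∃ ⟹ E4-∃** (the two tokens of the campaign): from `∃ μ_B w₁, …` (the shape of (G3) `parabolicIntegral_borel_three`) to `∃ β', …` (the hypothesis of ★ (G)), `β'` any `Γ'`-covering
weight (★ `exists_isCoveringWeight`; `Γ'` is discrete with `G(F)`, ★ `isDiscreteRational_quasiSplit`). [cite: Godement1964, §8] [cite: Garrett2018, §3.10 (proof of Cor. 3.10.2)] -/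
theorem exists_siegelIntegral_of_parabolicIntegral (μ : Measure (quasiSplit F E c N).Adelic) [μ.IsHaarMeasure]
    (hIw : ∀ g : (quasiSplit F E c N).Adelic, ∃ b ∈ borelAdelic F E c N, ∃ k : (quasiSplit F E c N).Adelic,
      adelicVal F E c N ((StdForm.antidiagonal N).over E) k ∈ standardMaximalCompactGL N E ∧ g = b * k)
    {τ : ℝ}
    (hE5 : ∃ (μB : Measure (borelAdelic F E c N)) (_ : μB.IsHaarMeasure) (w₁ : borelAdelic F E c N → ℝ≥0∞),
      IsCoveringWeight ↥(((quasiSplit F E c N).arithmeticSubgroup).subgroupOf (borelAdelic F E c N)) w₁ ∧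
      ∀ C₀ : ℝ≥0, ∫⁻ b, {b : borelAdelic F E c N | borelHeight (b : (quasiSplit F E c N).Adelic) ≤ C₀}.indicator
        (fun b => ENNReal.ofReal ((borelHeight (b : (quasiSplit F E c N).Adelic) : ℝ) ^ τ)) b * w₁ b ∂μB ≠ ∞) :
    ∃ β' : (quasiSplit F E c N).Adelic → ℝ≥0∞, IsCoveringWeight ↥(borelAdelic F E c N ⊓ (quasiSplit F E c N).arithmeticSubgroup) β' ∧
      ∀ C₀ : ℝ≥0, ∫⁻ y, {y | borelHeight y ≤ C₀}.indicator (fun y => ENNReal.ofReal ((borelHeight y : ℝ) ^ τ)) y * β' y ∂μ ≠ ∞ := by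
  obtain ⟨μB, hμB, w₁, hw₁, hI⟩ := hE5
  haveI : SecondCountableTopology (quasiSplit F E c N).Adelic := inferInstanceAs (SecondCountableTopology (adelic F E c N ((StdForm.antidiagonal N).over E)))
  haveI : DiscreteTopology (quasiSplit F E c N).arithmeticSubgroup := isDiscreteRational_quasiSplit
  haveI : DiscreteTopology ↥(borelAdelic F E c N ⊓ (quasiSplit F E c N).arithmeticSubgroup) :=
    DiscreteTopology.of_subset ‹DiscreteTopology (quasiSplit F E c N).arithmeticSubgroup› inf_le_right
  obtain ⟨β', hβ'⟩ := exists_isCoveringWeight (borelAdelic F E c N ⊓ (quasiSplit F E c N).arithmeticSubgroup)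
  exact ⟨β', hβ', fun C₀ => siegelIntegral_ne_top_of_parabolicIntegral μ hIw μB hw₁ hI hβ' C₀⟩

end Reduction

/-! ## §4 End-to-end modulo E5 -/

section EndToEnd

variable [NeZero N] [MeasurableSpace (quasiSplit F E c N).Adelic] [BorelSpace (quasiSplit F E c N).Adelic]

/-- **GODEMENT MODULO E5 (any `N`, hypothesis-first)**: Iwasawa + ceiling + E5(τ) ⟹ `∀ g, Summable (q ↦ H(γ̃_q g)^τ)` (★ (G) head ∘ §3). [cite: Godement1964, §8]
[cite: Garrett2018, §3.10 (Cor. 3.10.2)] [cite: MoeglinWaldspurger1995, II.1.5] -/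
theorem summable_borelHeight_rpow_of_parabolicIntegral (μ : Measure (quasiSplit F E c N).Adelic) [μ.IsHaarMeasure]
    (hIw : ∀ g : (quasiSplit F E c N).Adelic, ∃ b ∈ borelAdelic F E c N, ∃ k : (quasiSplit F E c N).Adelic,
      adelicVal F E c N ((StdForm.antidiagonal N).over E) k ∈ standardMaximalCompactGL N E ∧ g = b * k)
    (hceil : ∀ g : (quasiSplit F E c N).Adelic, ∃ C₀ : ℝ≥0, ∀ γ : ↥(unitaryGroupOfForm (c : E →+* E) ((StdForm.antidiagonal N).over E)),
      borelHeight ((quasiSplit F E c N).toAdelic γ * g) ≤ C₀)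
    {τ : ℝ} (hτ : 0 ≤ τ)
    (hE5 : ∃ (μB : Measure (borelAdelic F E c N)) (_ : μB.IsHaarMeasure) (w₁ : borelAdelic F E c N → ℝ≥0∞),
      IsCoveringWeight ↥(((quasiSplit F E c N).arithmeticSubgroup).subgroupOf (borelAdelic F E c N)) w₁ ∧
      ∀ C₀ : ℝ≥0, ∫⁻ b, {b : borelAdelic F E c N | borelHeight (b : (quasiSplit F E c N).Adelic) ≤ C₀}.indicator
        (fun b => ENNReal.ofReal ((borelHeight (b : (quasiSplit F E c N).Adelic) : ℝ) ^ τ)) b * w₁ b ∂μB ≠ ∞) :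
    ∀ g : (quasiSplit F E c N).Adelic,
      Summable fun q : Quotient (orbitRel ↥(borelU (c : E →+* E) ((StdForm.antidiagonal N).over E)) ↥(unitaryGroupOfForm (c : E →+* E) ((StdForm.antidiagonal N).over E))) =>
        ((borelHeight ((quasiSplit F E c N).toAdelic (Quotient.out q : ↥(unitaryGroupOfForm (c : E →+* E) ((StdForm.antidiagonal N).over E))) * g) : ℝ)) ^ τ := by
  haveI : T2Space (quasiSplit F E c N).Adelic := inferInstanceAs (T2Space (adelic F E c N ((StdForm.antidiagonal N).over E)))
  haveI : SecondCountableTopology (quasiSplit F E c N).Adelic := inferInstanceAs (SecondCountableTopology (adelic F E c N ((StdForm.antidiagonal N).over E)))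
  haveI : LocallyCompactSpace (quasiSplit F E c N).Adelic := inferInstanceAs (LocallyCompactSpace (adelic F E c N ((StdForm.antidiagonal N).over E)))
  exact summable_borelHeight_rpow_of_siegelIntegral μ hIw hceil hτ (exists_siegelIntegral_of_parabolicIntegral μ hIw hE5)

/-- The same with the locally uniform majorant (R4a shape on heights). [cite: Garrett2018, §3.10 (Cor. 3.10.2)] [cite: MoeglinWaldspurger1995, II.1.5] -/
theorem exists_nhds_summable_majorant_borelHeight_rpow_of_parabolicIntegral (μ : Measure (quasiSplit F E c N).Adelic) [μ.IsHaarMeasure]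
    (hIw : ∀ g : (quasiSplit F E c N).Adelic, ∃ b ∈ borelAdelic F E c N, ∃ k : (quasiSplit F E c N).Adelic,
      adelicVal F E c N ((StdForm.antidiagonal N).over E) k ∈ standardMaximalCompactGL N E ∧ g = b * k)
    (hceil : ∀ g : (quasiSplit F E c N).Adelic, ∃ C₀ : ℝ≥0, ∀ γ : ↥(unitaryGroupOfForm (c : E →+* E) ((StdForm.antidiagonal N).over E)),
      borelHeight ((quasiSplit F E c N).toAdelic γ * g) ≤ C₀)
    {τ : ℝ} (hτ : 0 ≤ τ)
    (hE5 : ∃ (μB : Measure (borelAdelic F E c N)) (_ : μB.IsHaarMeasure) (w₁ : borelAdelic F E c N → ℝ≥0∞),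
      IsCoveringWeight ↥(((quasiSplit F E c N).arithmeticSubgroup).subgroupOf (borelAdelic F E c N)) w₁ ∧
      ∀ C₀ : ℝ≥0, ∫⁻ b, {b : borelAdelic F E c N | borelHeight (b : (quasiSplit F E c N).Adelic) ≤ C₀}.indicator
        (fun b => ENNReal.ofReal ((borelHeight (b : (quasiSplit F E c N).Adelic) : ℝ) ^ τ)) b * w₁ b ∂μB ≠ ∞)
    (g₀ : (quasiSplit F E c N).Adelic) :
    ∃ U ∈ 𝓝 g₀, ∃ u : Quotient (orbitRel ↥(borelU (c : E →+* E) ((StdForm.antidiagonal N).over E)) ↥(unitaryGroupOfForm (c : E →+* E) ((StdForm.antidiagonal N).over E))) → ℝ,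
      Summable u ∧ ∀ g ∈ U, ∀ q,
        ((borelHeight ((quasiSplit F E c N).toAdelic (Quotient.out q : ↥(unitaryGroupOfForm (c : E →+* E) ((StdForm.antidiagonal N).over E))) * g) : ℝ)) ^ τ ≤ u q := by
  haveI : T2Space (quasiSplit F E c N).Adelic := inferInstanceAs (T2Space (adelic F E c N ((StdForm.antidiagonal N).over E)))
  haveI : SecondCountableTopology (quasiSplit F E c N).Adelic := inferInstanceAs (SecondCountableTopology (adelic F E c N ((StdForm.antidiagonal N).over E)))
  haveI : LocallyCompactSpace (quasiSplit F E c N).Adelic := inferInstanceAs (LocallyCompactSpace (adelic F E c N ((StdForm.antidiagonal N).over E)))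
  exact exists_nhds_summable_majorant_borelHeight_rpow μ hIw hceil hτ (exists_siegelIntegral_of_parabolicIntegral μ hIw hE5) g₀

end EndToEnd

section CM

variable (L : Type) [Field L] [NumberField L] [IsCMField L]
  [MeasurableSpace (quasiSplit (↥(maximalRealSubfield L)) L (IsCMField.complexConj L) 3).Adelic]
  [BorelSpace (quasiSplit (↥(maximalRealSubfield L)) L (IsCMField.complexConj L) 3).Adelic]

/-- **GODEMENT FOR `U(Φ₃)` OVER A CM FIELD MODULO E5**: for a Haar measure `μ` on `U(J₃)(𝔸_{L⁺})`, `τ ≥ 0` and E5(`τ`) (file (G3) supplies it for `τ > 2`), the height series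
`Σ_{q ∈ B(L⁺)∖U(J₃)(L⁺)} H(γ̃_q g)^τ` converges for every `g` (Iwasawa ★ CM, ceiling ★ big cell). [cite: Godement1964, §8] [cite: MoeglinWaldspurger1995, II.1.5] [cite: Rogawski1990, §2.2] -/
theorem summable_borelHeight_rpow_cm_three_of_parabolicIntegral
    (μ : Measure (quasiSplit (↥(maximalRealSubfield L)) L (IsCMField.complexConj L) 3).Adelic) [μ.IsHaarMeasure] {τ : ℝ} (hτ : 0 ≤ τ)
    (hE5 : ∃ (μB : Measure (borelAdelic (↥(maximalRealSubfield L)) L (IsCMField.complexConj L) 3)) (_ : μB.IsHaarMeasure)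
        (w₁ : borelAdelic (↥(maximalRealSubfield L)) L (IsCMField.complexConj L) 3 → ℝ≥0∞),
      IsCoveringWeight ↥(((quasiSplit (↥(maximalRealSubfield L)) L (IsCMField.complexConj L) 3).arithmeticSubgroup).subgroupOf
        (borelAdelic (↥(maximalRealSubfield L)) L (IsCMField.complexConj L) 3)) w₁ ∧
      ∀ C₀ : ℝ≥0, ∫⁻ b, {b : borelAdelic (↥(maximalRealSubfield L)) L (IsCMField.complexConj L) 3 |
          borelHeight (b : (quasiSplit (↥(maximalRealSubfield L)) L (IsCMField.complexConj L) 3).Adelic) ≤ C₀}.indicator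
        (fun b => ENNReal.ofReal ((borelHeight (b : (quasiSplit (↥(maximalRealSubfield L)) L (IsCMField.complexConj L) 3).Adelic) : ℝ) ^ τ)) b * w₁ b ∂μB ≠ ∞) :
    ∀ g : (quasiSplit (↥(maximalRealSubfield L)) L (IsCMField.complexConj L) 3).Adelic,
      Summable fun q : Quotient (orbitRel ↥(borelU ((IsCMField.complexConj L : L ≃ₐ[↥(maximalRealSubfield L)] L) : L →+* L) ((StdForm.antidiagonal 3).over L))
          ↥(unitaryGroupOfForm ((IsCMField.complexConj L : L ≃ₐ[↥(maximalRealSubfield L)] L) : L →+* L) ((StdForm.antidiagonal 3).over L))) =>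
        ((borelHeight ((quasiSplit (↥(maximalRealSubfield L)) L (IsCMField.complexConj L) 3).toAdelic
          (Quotient.out q : ↥(unitaryGroupOfForm ((IsCMField.complexConj L : L ≃ₐ[↥(maximalRealSubfield L)] L) : L →+* L) ((StdForm.antidiagonal 3).over L))) * g) : ℝ)) ^ τ :=
  summable_borelHeight_rpow_of_parabolicIntegral μ (exists_mem_borelAdelic_mul_mem_standardMaximalCompactGL_cm_three L)
    (fun g => ⟨_, fun γ => borelHeight_toAdelic_mul_le_max_three γ g⟩) hτ hE5

/-- **ABSOLUTE CONVERGENCE OF THE BOREL EISENSTEIN SERIES `E(f_z)` OF `U(Φ₃)` OVER A CM FIELD MODULO E5** (`‖φ‖ ≤ M`, `0 ≤ Re z`, E5(`Re z`)): `∀ g, Summable (q ↦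
‖flatSectionU φ z (γ̃_q g)‖)` — the norms of the terms of `eisensteinSeriesU (flatSectionU φ z) g`. [cite: Godement1964, §8] [cite: MoeglinWaldspurger1995, II.1.5]
[cite: Garrett2018, §3.10 (Cor. 3.10.2)] -/
theorem summable_norm_flatSectionU_cm_three_of_parabolicIntegral
    (μ : Measure (quasiSplit (↥(maximalRealSubfield L)) L (IsCMField.complexConj L) 3).Adelic) [μ.IsHaarMeasure] {z : ℂ} (hz : 0 ≤ z.re)
    (hE5 : ∃ (μB : Measure (borelAdelic (↥(maximalRealSubfield L)) L (IsCMField.complexConj L) 3)) (_ : μB.IsHaarMeasure)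
        (w₁ : borelAdelic (↥(maximalRealSubfield L)) L (IsCMField.complexConj L) 3 → ℝ≥0∞),
      IsCoveringWeight ↥(((quasiSplit (↥(maximalRealSubfield L)) L (IsCMField.complexConj L) 3).arithmeticSubgroup).subgroupOf
        (borelAdelic (↥(maximalRealSubfield L)) L (IsCMField.complexConj L) 3)) w₁ ∧
      ∀ C₀ : ℝ≥0, ∫⁻ b, {b : borelAdelic (↥(maximalRealSubfield L)) L (IsCMField.complexConj L) 3 |
          borelHeight (b : (quasiSplit (↥(maximalRealSubfield L)) L (IsCMField.complexConj L) 3).Adelic) ≤ C₀}.indicator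
        (fun b => ENNReal.ofReal ((borelHeight (b : (quasiSplit (↥(maximalRealSubfield L)) L (IsCMField.complexConj L) 3).Adelic) : ℝ) ^ z.re)) b * w₁ b ∂μB ≠ ∞)
    {φ : (quasiSplit (↥(maximalRealSubfield L)) L (IsCMField.complexConj L) 3).Adelic → ℂ} {M : ℝ} (hφ : ∀ x, ‖φ x‖ ≤ M)
    (g : (quasiSplit (↥(maximalRealSubfield L)) L (IsCMField.complexConj L) 3).Adelic) :
    Summable fun q : Quotient (orbitRel ↥(borelU ((IsCMField.complexConj L : L ≃ₐ[↥(maximalRealSubfield L)] L) : L →+* L) ((StdForm.antidiagonal 3).over L))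
        ↥(unitaryGroupOfForm ((IsCMField.complexConj L : L ≃ₐ[↥(maximalRealSubfield L)] L) : L →+* L) ((StdForm.antidiagonal 3).over L))) =>
      ‖flatSectionU φ z ((quasiSplit (↥(maximalRealSubfield L)) L (IsCMField.complexConj L) 3).toAdelic
          (Quotient.out q : ↥(unitaryGroupOfForm ((IsCMField.complexConj L : L ≃ₐ[↥(maximalRealSubfield L)] L) : L →+* L) ((StdForm.antidiagonal 3).over L))) * g)‖ := by
  refine Summable.of_nonneg_of_le (fun _ => norm_nonneg _) (fun q => ?_) ((summable_borelHeight_rpow_cm_three_of_parabolicIntegral L μ hz hE5 g).mul_left M)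
  rw [norm_flatSectionU]
  exact mul_le_mul_of_nonneg_right (hφ _) (Real.rpow_nonneg (NNReal.coe_nonneg _) _)

end CM

end Summit.HodgeConjecture.HodgeConjecture.Cruxes.H413.K2E1BorelParabolicReductionU

end
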